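import Literature.MathematicalPhysics.QuantumFieldTheory.Balaban1983to89.B9Eq3126H1kSupRowClosed
import Literature.MathematicalPhysics.QuantumFieldTheory.Balaban1983to89.B9Eq316PenaltyStencilLetterTower
import Literature.MathematicalPhysics.QuantumFieldTheory.Balaban1983to89.B9Eq315QkLocalLetter

/-!
# `Balaban1983to89.B9Eq3147MiddleWordSupRowClosed` — T. Bałaban, *Propagators for lattice gauge theories in a background field*, Commun. Math. Phys. **99** (1985)
# 389–434 [Balaban1985BackgroundPropagators] (3.147) p. 425 (*«𝔓 = I − G₁Q\*(QG₁Q\*)⁻¹Q − G₁DRD\*»*), (3.153) p. 426 (*«𝔊 = 𝔓G₁»*), (3.126) p. 420, Thm 3.3 p. 399,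
# Thm 3.11 p. 416, with [Balaban1985Variational] (110)–(111) p. 294: **THE SUP ROW OF THE MIDDLE WORD `G₁,kQ_k†(Q_kG₁,kQ_k†)⁻¹Q_kG₁,k = H₁,kQ_kG₁,k` OF `𝔊̃_k = 𝔓_kG₁,k`
# ON PRINT's DIAGONAL, `∃ (α₁, B, δ)` BEFORE THE HEIGHT** — the NE9 owner's plan v12 (`t4/b2b-balaban-t4-ne9-p1/g96/PLAN-V12-117-SOCKET.md` §2 (P1), «the words `𝔓_k`
# as tower operators with (L)-letters: `G₁,kQ_k†(Q_kG₁,kQ_k†)⁻¹Q_kG₁,k = H₁,kQ_kG₁,k` (letters: (K65) ∘ `Q_k` block letter ∘ (K64), by `letter_comp`)»), typed: TWO compositions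
# of this lineage's (K61) `B9Eq326G1SupRowOfLetters.letter_comp` on the coarse torus `T_m` — (K64) `B9Eq326G1kSupRowClosed.exists_local_letter_G1k` (fine bonds →
# fine bonds) ∘ THE `Q_k` LETTER (fine bonds → coarse bonds: RANGE `1` by ne9-leaf-03's `B9Eq315QkLocalLetter.QkOfU_apply_eq_zero_of_support`, SIZE `2√d·C_Q` by
# ne9-leaf-03's (PSK-tower) `B9Eq316PenaltyStencilLetterTower.norm_equiv_QkW_apply_le_blocks` — HEIGHT-FREE, the `√c₁` cancels against the bond-block mass `d·c₁`)
# ∘ (K65) `B9Eq3126H1kSupRowClosed.exists_local_letter_H1k` (coarse bonds → fine bonds)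

statement-level skeleton of published theorems with citation tags; proofs where landed; nothing here is a claim about the Yang–Mills mass gap

CITATION HEADER (lean-in-tree rule).  Audit cell `pub-balaban`, sub-cell `t4`, BINDER row NE9; filed by NE9 crux-team LEAF PROVER 05
(`b2b-balaban-t4-ne9-formalise-leaf-05`, gen 87).  Composed BY NAME, nothing restated: (K61) `letter_comp`, (K63) `B9Eq3126H1SupRowOfLetters.letter_of_range`,
(K64), (K65), ne9-leaf-03's `QkOfU_apply_eq_zero_of_support` ∕ `norm_equiv_QkW_apply_le_blocks` ∕ (SBLT) `B9Eq315QkSingleBondLetter.equiv_QkW_apply` ∕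
`B9Eq347LocalFromBlockDecay.norm_le_sqrt_mass_mul` ∕ (ECL) `B9Eq326LocalPartTowerSupDecayDiagonalClosed.sum_bondMass_bigBlock_le`, ne9-leaf-01's
`B9Eq349BlockMultipliers.exists_block_clm_family`, `B9Eq349BlockDistanceWeight.tdist_shift_le_one`, `B4Sect5Torus.torusSum_le` (the volume-free row constant `K_d`).
Sources READ first-hand this generation (`paper:balaban1985-cmp99-background-propagators`, journal page = PDF page + 388): p. 397 (3.42), p. 399 Thm 3.3, p. 420
(3.126), p. 425 (3.147), p. 426 (3.153).  NOTHING of print's proof is reproduced; no constant of print is valued.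

WHAT IS PROVED (sorry-free; proof lane — no `def`; [folklore] composition BY NAME).
* **`exists_local_letter_H1kQkG1k`** — `∃ α₁ B δ > 0` BEFORE `∀ n η c₀ c₁ m U …` ((K65)'s data block VERBATIM = (K64)'s + (FCLK)'s `hαL`): for every fine-bond field `f`
  supported over the big block `Π⁻¹(v)` with `‖f(b′)‖ ≤ F` and every fine bond `b`:
  `‖(H1k … hαL hpos (QkW … (G1k … hpos f)))(b)‖ ≤ B·e^{−δ·d_m(Π(b₋), v)}·F` — the middle term of `𝔊̃_kf = G₁,kf − H₁,kQ_kG₁,kf − G₁,kD_UR_kD*_UG₁,kf`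
  ((3.147), (3.153); the tree's `B11Eq111FrakG.frakPLin` at the tower, `H₁,k = G₁,k∘Q_k†∘(Q_kG₁,kQ_k†)⁻¹` by `B9Eq3126H1BlockDecayOfLettersTower.toCLM_H1k_eq`).
  Rates: `κ := min(δ_G, δ_H)`, the `Q_k` letter at rate `κ` (price `e^{κ}` for its range `1`), the rate lost ONCE (`δ := κ∕2`, both compositions with the row
  constant `K_d(κ∕2)`); `α₁ := min(α_G, α_H)`; `B = B_G·(2√d·C_Q(α₁)·e^{κ})·K·B_H·K`, `C_Q(α₁) = M_φ′M_φ·e^{√(L^d)√(2d)·102(d+1)²L·α₁∕(1−ϱ)}` (the geometric bond window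
  `ε_j ≤ αϱ^j`, `α ≤ α₁`).
HONEST SCOPE.  One of the three words of `𝔊̃_k`'s value row (plan v12 (P1)); the other two are (K64) itself and the `G₁,kD_UR_kD*_UG₁,k` word (ne9-leaf-03's (DGK) ∕
the `R_k` letters).  A theorem about the cell's MODEL; constants crude and symbolic; nothing of [B9] Thm 3.1 ∕ 3.3 ∕ 3.11 ∕ 3.13 or [B11] (117) asserted, valued or
discharged; «NE9 ⇐ the named binders»; NE9 NOT PRINTED ∕ NOT PROVED; row WALLED ON A MODEL (O-NE9-1; #5 UNRULED); spine PROVED 0∕9; rung (B)+1 on a finite T⁴ —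
NOT infinite volume, NOT mass gap, NOT BetaPertH, NOT Clay.  HONEST DEPENDENCY: continuum YM on T⁴ ⇐ BetaPertH ∧ nine spine estimates (0/9 proved); BetaPertH ⇐
(D1) ∧ (D4) ∧ CAP+tail; G-an2-4 gates asym, D1 and NE2/3/4.  NEW file importing BUILT modules ((K65), (PSK-tower), `B9Eq315QkLocalLetter`); nothing modified.
Net new unproved facts: 0.
-/

noncomputable section

set_option autoImplicit false

open scoped InnerProductSpace ComplexConjugate BigOperators

namespace Literature.MathematicalPhysics.QuantumFieldTheory.Balaban1983to89.B9Eq3147MiddleWordSupRowClosed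

open B4Sect5Torus (TSite tdist tdist_nonneg tdist_symm tdist_self tdist_triangle torusSum_le)
open B4Sect5Proof (latticeConst latticeConst_nonneg)
open B9SectCLatticeCarrier (Bond DirPair bpos btgt shift unshift)
open B9Eq311L2Pairing (WL2)
open B9Eq319QprimeTorus (fineP blockCoord)
open B7Prop1Explicit (U1 Wcx boxVec)
open B11Eq103H1Complex (SiteL2K BondL2K)
open B9Eq310DeltaPrime (plaqHolU)
open B9Eq310HessianOperator (adTransportW)
open B9Eq315QTorus (perCfg cornerSite)
open B9Eq315QTower (towerP UlevOf)
open B9Eq316TowerFlatIsOneStep (towerP_eq_fineP_pow siteCast)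
open B9Eq326OperatorTower (QkW laplaceAk G1k H1k)
open B9Eq324DeltaPrimeATower (laplacePrimeAk)
open B9Eq349BlockMultipliers (exists_block_clm_family)
open B9Eq349BlockDistanceWeight (tdist_shift_le_one)
open B9Eq326G1SupRowOfLetters (letter_comp)
open B9Eq3126H1SupRowOfLetters (letter_of_range)
open B9Eq326G1kSupRowClosed (exists_local_letter_G1k)
open B9Eq3126H1kSupRowClosed (exists_local_letter_H1k)
open B9Eq315QkLocalLetter (QkOfU_apply_eq_zero_of_support)
open B9Eq315QkSingleBondLetter (equiv_QkW_apply)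
open B9Eq316PenaltyStencilLetterTower (norm_equiv_QkW_apply_le_blocks)
open B9Eq347LocalFromBlockDecay (norm_le_sqrt_mass_mul)
open B9Eq326LocalPartTowerSupDecayDiagonalClosed (sum_bondMass_bigBlock_le)

variable {d : ℕ} (hd : 1 ≤ d) (L : ℕ) [NeZero L] (hL : 1 ≤ L) (hL3 : 3 ≤ L)
  {𝔸 : Type*} [NormedRing 𝔸] [NormedAlgebra ℂ 𝔸] [CompleteSpace 𝔸] [NormOneClass 𝔸] [StarRing 𝔸] [NormedStarGroup 𝔸] [StarModule ℂ 𝔸]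
  {W : Type*} [NormedAddCommGroup W] [InnerProductSpace ℂ W] [FiniteDimensional ℂ W] (φ : W ≃ₗ[ℂ] 𝔸)
  {Mφ Mφ' : ℝ} (hMφ : 0 ≤ Mφ) (hMφ' : 0 ≤ Mφ') (hφ : ∀ w, ‖φ w‖ ≤ Mφ * ‖w‖) (hφ' : ∀ X, ‖φ.symm X‖ ≤ Mφ' * ‖X‖) (hstar : ∀ X : 𝔸, ‖star X‖ ≤ ‖X‖)
  {a : ℝ} (ha : 0 < a) {a' : ℝ} (ha' : 0 < a') {ϱ : ℝ} (hϱ0 : 0 ≤ ϱ) (hϱ1 : ϱ < 1)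
  (τ : 𝔸 →ₗ[ℂ] ℂ) {Cτ : ℝ} (hτ : ∀ X, ‖τ X‖ ≤ Cτ * ‖X‖) (hCτ : 0 ≤ Cτ) {Mτ : ℝ} (hτm : ∀ X Y : 𝔸, ‖τ (X * Y)‖ ≤ Mτ * ‖X‖ * ‖Y‖) (hMτ : 0 ≤ Mτ)
  {ρw : ℝ} (hρw : 0 ≤ ρw)
  (hτ₁ : ∀ X : 𝔸, τ (star X) = conj (τ X)) (hτ₂ : ∀ X Y : 𝔸, τ (X * Y) = τ (Y * X)) (hφτ : ∀ X Y : 𝔸, ⟪φ.symm X, φ.symm Y⟫_ℂ = τ (star X * Y))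
  (AQ : ℝ)

omit [NeZero L] in
/-- `e^{−r t} ≤ e^{−κ t}` for `κ ≤ r`, `0 ≤ t`. [folklore] -/
private theorem exp_weaken' {r κ t : ℝ} (hκ : κ ≤ r) (ht : 0 ≤ t) : Real.exp (-(r * t)) ≤ Real.exp (-(κ * t)) :=
  Real.exp_le_exp.2 (by nlinarith)

include hd hL hL3 hMφ hMφ' hφ hφ' hstar ha ha' hϱ0 hϱ1 hτ hCτ hτm hMτ hρw hτ₁ hτ₂ hφτ in
/-- **THE SUP ROW OF THE MIDDLE WORD `H₁,kQ_kG₁,k` ON PRINT's DIAGONAL, UNCONDITIONAL on the cell's MODEL letters.**  (K64) `exists_local_letter_G1k` (`(α_G, B_G, δ_G)`),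
(K65) `exists_local_letter_H1k` (`(α_H, B_H, δ_H)`), the `Q_k` letter (range `1`: `QkOfU_apply_eq_zero_of_support` + `tdist_shift_le_one`; size `2√d·C_Q(α₁)`:
`norm_equiv_QkW_apply_le_blocks` × `norm_le_sqrt_mass_mul` × `sum_bondMass_bigBlock_le`), packaged by (K63) `letter_of_range` and composed twice by (K61) `letter_comp`
with `torusSum_le`; `κ := min(δ_G, δ_H)`, `δ := κ∕2`, `α₁ := min(α_G, α_H)`.
[cite: Balaban1985BackgroundPropagators, (3.147) p.425, (3.153) p.426, (3.126) p.420, Thm 3.3 p.399, Thm 3.11 p.416; Balaban1985Variational, (111) p.294] -/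
theorem exists_local_letter_H1kQkG1k :
    ∃ α₁ B δ : ℝ, 0 < α₁ ∧ 0 ≤ B ∧ 0 < δ ∧
      ∀ (n : ℕ) (η : ℝ) (_hηL : η * (L : ℝ) ^ (n + 1) = 1) (c₀ c₁ : ℝ) [Fact (0 < c₀)] [Fact (0 < c₁)]
        (_hw : c₀ * ((L : ℝ) ^ (n + 1)) ^ d = c₁) (_hρ : |η| ^ d / c₀ ≤ ρw) (m : Fin d → ℕ) [∀ i, NeZero (m i)] (_hm : ∀ i, 1 ≤ m i)
        (U : Bond d (towerP L m (n + 1)) → 𝔸ˣ) (αU : ℕ → ℝ) (_hα0 : ∀ j, 0 ≤ αU j) (hα1 : ∀ j, αU j ≤ 1 / 64)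
        (hαL : ∀ j, 50 * (d + 1) * αU j * (L : ℝ) ^ d ≤ 1 / 2)
        (hU1 : ∀ (j : ℕ) (x : B7Prop1Explicit.Site d) (k : Fin d), perCfg (towerP L m (j + 1)) (UlevOf L m (n + 1) U j) x k ∈ U1 𝔸)
        (hreg : ∀ (j : ℕ) (y : TSite d (towerP L m j)) (k : Fin d) (ρ' : Fin d → Fin L),
          ‖((Wcx L (perCfg (towerP L m (j + 1)) (UlevOf L m (n + 1) U j)) (cornerSite L y) k (boxVec L ρ') : 𝔸ˣ) : 𝔸) - 1‖ ≤ αU j)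
        (εU : ℕ → ℝ) (_hεU : ∀ j, 0 ≤ εU j) (_hUε : ∀ (j : ℕ) (b : Bond d (towerP L m (j + 1))), ‖(UlevOf L m (n + 1) U j b : 𝔸) - 1‖ ≤ εU j)
        (_hLb : ∀ (j : ℕ) (b : Bond d (towerP L m (j + 1))), UlevOf L m (n + 1) U j b ∈ U1 𝔸)
        (α : ℝ) (_hα : 0 ≤ α) (_hαle : α ≤ α₁)
        (hUst : ∀ b, star (U b : 𝔸) = (((U b)⁻¹ : 𝔸ˣ) : 𝔸)) (_hUb : ∀ b, U b ∈ U1 𝔸) (_hUη : ∀ b, ‖(U b : 𝔸) - 1‖ ≤ α * η)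
        (_hpl : ∀ p : B9SectCLatticeCarrier.Plaq d (towerP L m (n + 1)), ‖(plaqHolU U p : 𝔸) - 1‖ ≤ α * η ^ 2)
        (_hUgrad : ∀ (x : TSite d (towerP L m (n + 1))) (μ : Fin d), ‖(U (x, μ) : 𝔸) - U (unshift μ x, μ)‖ ≤ α * η ^ 2)
        (_hRlev : ∀ (j : ℕ) (b : Bond d (towerP L m (j + 1))) (w : W), ‖adTransportW φ (UlevOf L m (n + 1) U j) b w‖ ≤ ‖w‖)
        (_hεg : ∀ j < n + 1, εU j ≤ α * ϱ ^ j) (_hAQ : ∑ j ∈ Finset.range (n + 1), αU j ≤ AQ)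
        (hpos' : ∀ x : SiteL2K ℂ d (towerP L m (n + 1)) c₀ W, x ≠ 0 → 0 < RCLike.re ⟪x, laplacePrimeAk L m n φ η U a' (c₁ := c₁) x⟫_ℂ)
        (hpos : ∀ x : BondL2K ℂ d (towerP L m (n + 1)) c₀ W, x ≠ 0 →
          0 < RCLike.re ⟪x, laplaceAk L m n φ η U hL αU hα1 hU1 hreg τ (c₀ := c₀) (c₁ := c₁) a x⟫_ℂ)
        (v : TSite d m) (f : BondL2K ℂ d (towerP L m (n + 1)) c₀ W) (F : ℝ)
        (_hfv : ∀ b', blockCoord (L ^ (n + 1)) m (siteCast (towerP_eq_fineP_pow L m (n + 1)) (bpos b')) ≠ v →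
          WL2.equiv ℂ (fun _ : Bond d (towerP L m (n + 1)) => c₀) W f b' = 0)
        (_hfF : ∀ b', ‖WL2.equiv ℂ (fun _ : Bond d (towerP L m (n + 1)) => c₀) W f b'‖ ≤ F) (b : Bond d (towerP L m (n + 1))),
        ‖WL2.equiv ℂ (fun _ : Bond d (towerP L m (n + 1)) => c₀) W
            (H1k L m n φ η U hL αU hα1 hU1 hreg τ (c₀ := c₀) (c₁ := c₁) hαL hpos
              (QkW L m n φ U hL αU hα1 hU1 hreg (c₀ := c₀) (c₁ := c₁) (G1k L m n φ η U hL αU hα1 hU1 hreg τ (c₀ := c₀) (c₁ := c₁) hpos f))) b‖ ≤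
          B * Real.exp (-(δ * tdist m (blockCoord (L ^ (n + 1)) m (siteCast (towerP_eq_fineP_pow L m (n + 1)) (bpos b))) v)) * F := by
  classical
  obtain ⟨αG, BG, δG, hαG, hBG, hδG, HG⟩ := exists_local_letter_G1k hd L hL hL3 φ hMφ hMφ' hφ hφ' hstar ha ha' hϱ0 hϱ1 τ hτ hCτ hτm hMτ hρw hτ₁ hτ₂ hφτ AQ
  obtain ⟨αH, BH, δH, hαH, hBH, hδH, HH⟩ := exists_local_letter_H1k hd L hL hL3 φ hMφ hMφ' hφ hφ' hstar ha ha' hϱ0 hϱ1 τ hτ hCτ hτm hMτ hρw hτ₁ hτ₂ hφτ AQ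
  set κ : ℝ := min δG δH with hκdef
  have hκ0 : 0 < κ := lt_min hδG hδH
  have hκG : κ ≤ δG := min_le_left _ _
  have hκH : κ ≤ δH := min_le_right _ _
  have hα₁0 : 0 < min αG αH := lt_min hαG hαH
  -- the height-free size of `Q_k` at the window `α₁ = min(α_G, α_H)`
  set CQ : ℝ := Mφ' * Mφ * Real.exp (Real.sqrt ((L : ℝ) ^ d) * (Real.sqrt (2 * d) * (102 * (d + 1) ^ 2 * L)) * (min αG αH / (1 - ϱ))) with hCQ
  have hCQ0 : 0 ≤ CQ := by positivity
  set MQ : ℝ := CQ * (2 * Real.sqrt d) * Real.exp (κ * 1) with hMQ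
  have hMQ0 : 0 ≤ MQ := by positivity
  set K : ℝ := latticeConst d (κ - κ / 2) with hKdef
  have hK0 : 0 ≤ K := latticeConst_nonneg d (by linarith)
  set Bs : ℝ := BG * MQ * K * BH * K with hBs
  have hBs0 : 0 ≤ Bs := by positivity
  refine ⟨min αG αH, Bs, κ / 2, hα₁0, hBs0, by positivity, ?_⟩
  intro n η hηL c₀ c₁ _ _ hw hρ m _ hm U αU hα0 hα1 hαL hU1 hreg εU hεU hUε hLb α hα hαle hUst hUb hUη hpl hUgrad hRlev hεg hAQ hpos' hpos v f F hfv hfF b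
  have hc₀ : (0 : ℝ) < c₀ := Fact.out
  have hc₁ : (0 : ℝ) < c₁ := Fact.out
  haveI : Nonempty (Bond d (towerP L m (n + 1))) := ⟨b⟩
  haveI : Nonempty (Bond d m) := ⟨(v, ⟨0, hd⟩)⟩
  -- the fine bond-block family
  obtain ⟨PB, hPB⟩ := exists_block_clm_family (𝕜 := ℂ) (w := fun _ : Bond d (towerP L m (n + 1)) => c₀) (V := W)
    (fun b' : Bond d (towerP L m (n + 1)) => blockCoord (L ^ (n + 1)) m (siteCast (towerP_eq_fineP_pow L m (n + 1)) (bpos b')))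
  -- the three CLMs
  obtain ⟨Gcl, hGcl⟩ : ∃ T : BondL2K ℂ d (towerP L m (n + 1)) c₀ W →L[ℂ] BondL2K ℂ d (towerP L m (n + 1)) c₀ W,
      T = LinearMap.toContinuousLinearMap (G1k L m n φ η U hL αU hα1 hU1 hreg τ (c₀ := c₀) (c₁ := c₁) hpos) := ⟨_, rfl⟩
  obtain ⟨Qcl, hQcl⟩ : ∃ T : BondL2K ℂ d (towerP L m (n + 1)) c₀ W →L[ℂ] BondL2K ℂ d m c₁ W,
      T = LinearMap.toContinuousLinearMap (QkW L m n φ U hL αU hα1 hU1 hreg (c₀ := c₀) (c₁ := c₁)) := ⟨_, rfl⟩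
  obtain ⟨Hcl, hHcl⟩ : ∃ T : BondL2K ℂ d m c₁ W →L[ℂ] BondL2K ℂ d (towerP L m (n + 1)) c₀ W,
      T = LinearMap.toContinuousLinearMap (H1k L m n φ η U hL αU hα1 hU1 hreg τ (c₀ := c₀) (c₁ := c₁) hαL hpos) := ⟨_, rfl⟩
  -- (L)(G₁,k; B_G, κ)
  have hG : ∀ (v : TSite d m) (f : BondL2K ℂ d (towerP L m (n + 1)) c₀ W) (F : ℝ),
      (∀ x, blockCoord (L ^ (n + 1)) m (siteCast (towerP_eq_fineP_pow L m (n + 1)) (bpos x)) ≠ v →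
        WL2.equiv ℂ (fun _ : Bond d (towerP L m (n + 1)) => c₀) W f x = 0) →
      (∀ x, ‖WL2.equiv ℂ (fun _ : Bond d (towerP L m (n + 1)) => c₀) W f x‖ ≤ F) →
      ∀ x, ‖WL2.equiv ℂ (fun _ : Bond d (towerP L m (n + 1)) => c₀) W (Gcl f) x‖ ≤
        BG * Real.exp (-(κ * tdist m (blockCoord (L ^ (n + 1)) m (siteCast (towerP_eq_fineP_pow L m (n + 1)) (bpos x))) v)) * F := by
    intro v f F hfv hfF x
    have hF : 0 ≤ F := (norm_nonneg _).trans (hfF x)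
    have h := HG n η hηL c₀ c₁ hw hρ m hm U αU hα0 hα1 hU1 hreg εU hεU hUε hLb α hα (hαle.trans (min_le_left _ _)) hUst hUb hUη hpl hUgrad hRlev hεg hAQ
      hpos' hpos v f F hfv hfF x
    rw [hGcl, LinearMap.coe_toContinuousLinearMap']
    exact h.trans (mul_le_mul_of_nonneg_right (mul_le_mul_of_nonneg_left (exp_weaken' hκG (tdist_nonneg m _ _)) hBG) hF)
  -- (L)(H₁,k; B_H, κ)
  have hH : ∀ (v : TSite d m) (z : BondL2K ℂ d m c₁ W) (F : ℝ), (∀ x, bpos x ≠ v → WL2.equiv ℂ (fun _ : Bond d m => c₁) W z x = 0) →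
      (∀ x, ‖WL2.equiv ℂ (fun _ : Bond d m => c₁) W z x‖ ≤ F) →
      ∀ x, ‖WL2.equiv ℂ (fun _ : Bond d (towerP L m (n + 1)) => c₀) W (Hcl z) x‖ ≤
        BH * Real.exp (-(κ * tdist m (blockCoord (L ^ (n + 1)) m (siteCast (towerP_eq_fineP_pow L m (n + 1)) (bpos x))) v)) * F := by
    intro v z F hzv hzF x
    have hF : 0 ≤ F := (norm_nonneg _).trans (hzF (v, ⟨0, hd⟩))
    have h := HH n η hηL c₀ c₁ hw hρ m hm U αU hα0 hα1 hαL hU1 hreg εU hεU hUε hLb α hα (hαle.trans (min_le_right _ _)) hUst hUb hUη hpl hUgrad hRlev hεg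
      hAQ hpos' hpos v z F hzv hzF x
    rw [hHcl, LinearMap.coe_toContinuousLinearMap']
    exact h.trans (mul_le_mul_of_nonneg_right (mul_le_mul_of_nonneg_left (exp_weaken' hκH (tdist_nonneg m _ _)) hBH) hF)
  -- the bond-block mass `d·c₁` and the block norms of a bounded field
  have hμB : ∀ u : TSite d m, ∑ x : Bond d (towerP L m (n + 1)),
      (if blockCoord (L ^ (n + 1)) m (siteCast (towerP_eq_fineP_pow L m (n + 1)) (bpos x)) = u then c₀ else 0) ≤ (d : ℝ) * c₁ := by
    intro u
    have h := sum_bondMass_bigBlock_le L m n hc₀.le u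
    calc _ ≤ c₀ * (d * ((L : ℝ) ^ (n + 1)) ^ d) := h
      _ = (d : ℝ) * c₁ := by rw [← hw]; ring
  have hblk : ∀ (u : BondL2K ℂ d (towerP L m (n + 1)) c₀ W) (F : ℝ), 0 ≤ F →
      (∀ x, ‖WL2.equiv ℂ (fun _ : Bond d (towerP L m (n + 1)) => c₀) W u x‖ ≤ F) → ∀ y : TSite d m, ‖PB y u‖ ≤ Real.sqrt ((d : ℝ) * c₁) * F := by
    intro u F hF huF y
    refine norm_le_sqrt_mass_mul (w := fun _ : Bond d (towerP L m (n + 1)) => c₀)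
      (π := fun b' : Bond d (towerP L m (n + 1)) => blockCoord (L ^ (n + 1)) m (siteCast (towerP_eq_fineP_pow L m (n + 1)) (bpos b')))
      y (hμB y) (PB y u) hF (fun x hx => ?_) (fun x => ?_)
    · rw [hPB, if_neg hx]
    · rw [hPB]
      by_cases hx : blockCoord (L ^ (n + 1)) m (siteCast (towerP_eq_fineP_pow L m (n + 1)) (bpos x)) = y
      · rw [if_pos hx]; exact huF x
      · rw [if_neg hx, norm_zero]; exact hF
  -- `Q_k`: size (height-free) and range `1`
  have hsd : Real.sqrt ((d : ℝ) * c₁) = Real.sqrt d * Real.sqrt c₁ := Real.sqrt_mul (Nat.cast_nonneg d) c₁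
  have hsc : 0 < Real.sqrt c₁ := Real.sqrt_pos.2 hc₁
  have hexpα : Real.exp (Real.sqrt ((L : ℝ) ^ d) * (Real.sqrt (2 * d) * (102 * (d + 1) ^ 2 * L)) * (α / (1 - ϱ))) ≤
      Real.exp (Real.sqrt ((L : ℝ) ^ d) * (Real.sqrt (2 * d) * (102 * (d + 1) ^ 2 * L)) * (min αG αH / (1 - ϱ))) := by
    have h1ϱ : 0 < 1 - ϱ := by linarith
    exact Real.exp_le_exp.2 (mul_le_mul_of_nonneg_left (div_le_div_of_nonneg_right hαle h1ϱ.le) (by positivity))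
  have hQM : ∀ (u : BondL2K ℂ d (towerP L m (n + 1)) c₀ W) (F : ℝ), (∀ x, ‖WL2.equiv ℂ (fun _ : Bond d (towerP L m (n + 1)) => c₀) W u x‖ ≤ F) →
      ∀ c, ‖WL2.equiv ℂ (fun _ : Bond d m => c₁) W (Qcl u) c‖ ≤ CQ * (2 * Real.sqrt d) * F := by
    intro u F huF c
    have hF : 0 ≤ F := (norm_nonneg _).trans (huF b)
    have h := norm_equiv_QkW_apply_le_blocks L m n φ U hL αU hα1 hU1 hreg hMφ hφ hMφ' hφ' εU hεU hUε hϱ0 hϱ1 hα hεg hPB hw.symm u c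
    have h1 := hblk u F hF huF c.1
    have h2 := hblk u F hF huF (shift c.2 c.1)
    rw [hQcl, LinearMap.coe_toContinuousLinearMap']
    refine h.trans ?_
    calc Mφ' * Mφ * Real.exp (Real.sqrt ((L : ℝ) ^ d) * (Real.sqrt (2 * d) * (102 * (d + 1) ^ 2 * L)) * (α / (1 - ϱ))) / Real.sqrt c₁ *
          (‖PB c.1 u‖ + ‖PB (shift c.2 c.1) u‖)
        ≤ Mφ' * Mφ * Real.exp (Real.sqrt ((L : ℝ) ^ d) * (Real.sqrt (2 * d) * (102 * (d + 1) ^ 2 * L)) * (min αG αH / (1 - ϱ))) / Real.sqrt c₁ *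
          (Real.sqrt ((d : ℝ) * c₁) * F + Real.sqrt ((d : ℝ) * c₁) * F) := by
          refine mul_le_mul ?_ (add_le_add h1 h2) (by positivity) (by positivity)
          exact div_le_div_of_nonneg_right (mul_le_mul_of_nonneg_left hexpα (by positivity)) hsc.le
      _ = CQ * (2 * Real.sqrt d) * F := by
          rw [hCQ, hsd]
          field_simp
          ring
  have hQρ : ∀ (v : TSite d m) (u : BondL2K ℂ d (towerP L m (n + 1)) c₀ W),
      (∀ x, blockCoord (L ^ (n + 1)) m (siteCast (towerP_eq_fineP_pow L m (n + 1)) (bpos x)) ≠ v →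
        WL2.equiv ℂ (fun _ : Bond d (towerP L m (n + 1)) => c₀) W u x = 0) →
      ∀ c : Bond d m, (1 : ℝ) < tdist m (bpos c) v → WL2.equiv ℂ (fun _ : Bond d m => c₁) W (Qcl u) c = 0 := by
    intro v u huv c hc
    have h1 : c.1 ≠ v := by
      intro h1
      have : tdist m (bpos c) v = 0 := by rw [show bpos c = c.1 from rfl, h1, tdist_self]
      linarith
    have h2 : shift c.2 c.1 ≠ v := by
      intro h2
      have : tdist m (bpos c) v ≤ 1 := by rw [show bpos c = c.1 from rfl, ← h2]; exact tdist_shift_le_one hm c.1 c.2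
      linarith
    rw [hQcl, LinearMap.coe_toContinuousLinearMap', equiv_QkW_apply,
      QkOfU_apply_eq_zero_of_support L m hL (n + 1) U αU hα1 hU1 hreg v _ (fun b' hb' => by rw [huv b' hb', map_zero]) c h1 h2, map_zero]
  have hQ := letter_of_range (tdist m)
    (fun x : Bond d (towerP L m (n + 1)) => blockCoord (L ^ (n + 1)) m (siteCast (towerP_eq_fineP_pow L m (n + 1)) (bpos x)))
    (fun c : Bond d m => bpos c) Qcl hκ0.le hQM hQρ
  -- the two compositions on the torus, the rate lost once
  have hgap : 0 < κ - κ / 2 := by linarith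
  have hS : ∀ w : TSite d m, ∑ u : TSite d m, Real.exp (-((κ - κ / 2) * tdist m w u)) ≤ K := fun w => torusSum_le d hm hgap w
  have h₁ := letter_comp (tdist m)
    (fun x : Bond d (towerP L m (n + 1)) => blockCoord (L ^ (n + 1)) m (siteCast (towerP_eq_fineP_pow L m (n + 1)) (bpos x)))
    (fun x : Bond d (towerP L m (n + 1)) => blockCoord (L ^ (n + 1)) m (siteCast (towerP_eq_fineP_pow L m (n + 1)) (bpos x)))
    (fun c : Bond d m => bpos c) Gcl Qcl (tdist_nonneg m) (fun u y w => tdist_triangle hm u y w) hBG hMQ0 (by positivity : (0 : ℝ) ≤ κ / 2)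
    (by linarith : κ / 2 ≤ κ) hG hQ hS
  have h₂ := letter_comp (tdist m)
    (fun x : Bond d (towerP L m (n + 1)) => blockCoord (L ^ (n + 1)) m (siteCast (towerP_eq_fineP_pow L m (n + 1)) (bpos x)))
    (fun c : Bond d m => bpos c)
    (fun x : Bond d (towerP L m (n + 1)) => blockCoord (L ^ (n + 1)) m (siteCast (towerP_eq_fineP_pow L m (n + 1)) (bpos x)))
    (Qcl ∘L Gcl) Hcl (tdist_nonneg m) (fun u y w => tdist_triangle hm u y w) (by positivity : (0 : ℝ) ≤ BG * MQ * K) hBH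
    (by positivity : (0 : ℝ) ≤ κ / 2) le_rfl h₁ hH hS v f F hfv hfF b
  have e : (Hcl ∘L (Qcl ∘L Gcl)) f =
      H1k L m n φ η U hL αU hα1 hU1 hreg τ (c₀ := c₀) (c₁ := c₁) hαL hpos
        (QkW L m n φ U hL αU hα1 hU1 hreg (c₀ := c₀) (c₁ := c₁) (G1k L m n φ η U hL αU hα1 hU1 hreg τ (c₀ := c₀) (c₁ := c₁) hpos f)) := by
    rw [hHcl, hQcl, hGcl]
    rfl
  rw [e] at h₂
  rw [hBs]
  exact h₂

end Literature.MathematicalPhysics.QuantumFieldTheory.Balaban1983to89.B9Eq3147MiddleWordSupRowClosed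

end
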